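import Literature.Barriers.QuantumFields.FiniteTemperatureReflection
import HarnessLib

/-!
# The time-sliced transfer kernel of the finite-temperature Wilson lattice gauge theory — PROVED

Topic `Literature/MathematicalPhysics/QuantumFieldTheory`; companion of
`Literature.Barriers.QuantumFields.FiniteTemperatureDeconfinement` (`FiniteTemperature.Config`,
`.weight ρ J_E J_M`, `.haar`) and `FiniteTemperatureReflection` (`magSlice`, `elecSlice`,
`minusAction_eq_sum_slices`). The classical TRANSFER-MATRIX representation of the periodic-time
ensemble (Osterwalder–Seiler 1978 §2–3; Lüscher 1977; Seiler LNP 159 §2): slicing a configuration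
into spatial links `V t : ((ℤ/L)^d × Fin d) → G` and temporal links `E t : (ℤ/L)^d → G`,
* the a-priori measure is the product of the slice Haar measures (`map_assemble_eq_haar`,
  `integral_haar_eq_integral_assemble`);
* definitions `magSum ρ` (spatial plaquette sum of a slice), `elecSum ρ a E b` (temporal plaquette
  sum between consecutive slices) and the symmetrised kernel
  `sliceKernel ρ J_E J_M a b = e^{J_M magSum a/2} (∫ e^{J_E elecSum a E b} dE) e^{J_M magSum b/2}`;
* `weight_assemble_eq_prod` (the weight factorises over time), and, integrating out the temporal
  links (Fubini + `integral_fintype_prod_eq_prod`), the CYCLIC KERNEL CHAIN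
  `∫ Ψ e^{−S} dU = ∫ Ψ(V) ∏_t sliceKernel(V t, V (t+1)) dV` for every continuous observable `Ψ` of the
  spatial links (`integral_obs_mul_weight_eq_integral_sliceKernel`, **main**);
* `sliceKernel` is continuous, bounded, strictly positive and SYMMETRIC (`E ↦ E⁻¹`, inversion
  invariance of the Haar measure, `Re tr ρ(g⁻¹) = Re tr ρ(g)` for unitary `ρ`), independent of `L₀`.
With `Literature.Analysis.OperatorTheory` (Jentzsch gap of positive symmetric kernels) this is the
input for exponential clustering in time at FIXED spatial lattice, uniformly in `L₀`.
References: K. Osterwalder, E. Seiler, Ann. Phys. 110 (1978) 440, §2–3; E. Seiler, LNP 159 (1982)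
§2; M. Lüscher, Commun. Math. Phys. 54 (1977) 283. [OsterwalderSeiler1978] [Seiler1982] [Luscher1977]
-/

noncomputable section

open MeasureTheory Filter Topology Function
open Literature.Barriers.QuantumFields

namespace Literature.MathematicalPhysics.QuantumFieldTheory

section Slices

variable {d L₀ L : ℕ} {G : Type*} {N : ℕ}

/-- The preimage of a box of link sets under assembling is a product of boxes of slices. [folklore] -/
theorem preimage_assemble_pi (s : FiniteTemperature.Site d L₀ L × FiniteTemperature.Dir d → Set G) :
    (fun VE : (ZMod L₀ → ((Fin d → ZMod L) × Fin d → G)) ×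
        (ZMod L₀ → ((Fin d → ZMod L) → G)) =>
      fun e : FiniteTemperature.Site d L₀ L × FiniteTemperature.Dir d => e.2.elim (VE.2 e.1.1 e.1.2) fun i => VE.1 e.1.1 (e.1.2, i)) ⁻¹'
        Set.pi Set.univ s =
      (Set.pi Set.univ fun t : ZMod L₀ => Set.pi Set.univ fun p : (Fin d → ZMod L) × Fin d =>
          s ((t, p.1), some p.2)) ×ˢ
        (Set.pi Set.univ fun t : ZMod L₀ => Set.pi Set.univ fun x : Fin d → ZMod L =>
          s ((t, x), none)) := by
  ext VE
  simp only [Set.mem_preimage, Set.mem_pi, Set.mem_univ, true_implies, Set.mem_prod]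
  constructor
  · intro h
    exact ⟨fun t p => h ((t, p.1), some p.2), fun t x => h ((t, x), none)⟩
  · rintro ⟨h1, h2⟩ ⟨⟨t, x⟩, _ | i⟩
    · exact h2 t x
    · exact h1 t (x, i)

variable [Group G] (ρ : G →* Matrix (Fin N) (Fin N) ℂ)

omit [Group G] in
/-- **Assembling a configuration from its time slices** is measurable: spatial links
`V t (x, i) ↦ U((t, x), i)`, temporal links `E t x ↦ U((t, x), time)`. [folklore] -/
theorem measurable_assemble [MeasurableSpace G] :
    Measurable fun VE : (ZMod L₀ → ((Fin d → ZMod L) × Fin d → G)) ×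
        (ZMod L₀ → ((Fin d → ZMod L) → G)) =>
      fun e : FiniteTemperature.Site d L₀ L × FiniteTemperature.Dir d => e.2.elim (VE.2 e.1.1 e.1.2) fun i => VE.1 e.1.1 (e.1.2, i) := by
  refine measurable_pi_lambda _ fun e => ?_
  rcases e with ⟨⟨t, x⟩, _ | i⟩
  · exact (measurable_pi_apply x).comp ((measurable_pi_apply t).comp measurable_snd)
  · exact (measurable_pi_apply (x, i)).comp ((measurable_pi_apply t).comp measurable_fst)

omit [Group G] in
/-- Continuity of the assembling map. [folklore] -/
theorem continuous_assemble [TopologicalSpace G] :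
    Continuous fun VE : (ZMod L₀ → ((Fin d → ZMod L) × Fin d → G)) ×
        (ZMod L₀ → ((Fin d → ZMod L) → G)) =>
      fun e : FiniteTemperature.Site d L₀ L × FiniteTemperature.Dir d =>
        e.2.elim (VE.2 e.1.1 e.1.2) fun i => VE.1 e.1.1 (e.1.2, i) := by
  refine continuous_pi fun e => ?_
  rcases e with ⟨⟨t, x⟩, _ | i⟩
  · exact (continuous_apply x).comp ((continuous_apply t).comp continuous_snd)
  · exact (continuous_apply (x, i)).comp ((continuous_apply t).comp continuous_fst)

/-- The **spatial ("magnetic") plaquette sum of one time slice**: `Σ_x Σ_{i<j} Re tr ρ(U_P)` over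
the plaquettes of the spatial box `(ℤ/L)^d` for a configuration `a` of its (positively oriented)
links `(x, i)`; `FiniteTemperature.magSlice t` of a configuration is `magSum` of its `t`-th spatial
slice (`magSlice_assemble`). [cite: BorgsSeiler1983, §II.3 (II.20) (pp. 335–336)] -/
def magSum [NeZero L] (a : (Fin d → ZMod L) × Fin d → G) : ℝ :=
  ∑ x : Fin d → ZMod L, ∑ p : {p : Fin d × Fin d // p.1 < p.2},
    (ρ (a (x, p.1.1) * a (x + Pi.single p.1.1 1, p.1.2) * (a (x + Pi.single p.1.2 1, p.1.1))⁻¹ *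
      (a (x, p.1.2))⁻¹)).trace.re

/-- The **temporal ("electric") plaquette sum between two consecutive time slices**:
`Σ_x Σ_i Re tr ρ(E_x b_{x,i} E_{x+eᵢ}⁻¹ a_{x,i}⁻¹)` for spatial links `a` (earlier slice), `b` (later
slice) and the temporal links `E` joining them; `FiniteTemperature.elecSlice t` of a configuration is
`elecSum` of its slices `t`, `t + 1` (`elecSlice_assemble`). [cite: BorgsSeiler1983, §II.3 (II.20) and §III.1 (III.1) (pp. 335–336, 344)] -/
def elecSum [NeZero L] (a : (Fin d → ZMod L) × Fin d → G) (E : (Fin d → ZMod L) → G)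
    (b : (Fin d → ZMod L) × Fin d → G) : ℝ :=
  ∑ x : Fin d → ZMod L, ∑ i : Fin d,
    (ρ (E x * b (x, i) * (E (x + Pi.single i 1))⁻¹ * (a (x, i))⁻¹)).trace.re

/-- `magSlice t` of an assembled configuration is `magSum` of the `t`-th spatial slice. [folklore] -/
theorem magSlice_assemble [NeZero L] (V : ZMod L₀ → ((Fin d → ZMod L) × Fin d → G))
    (E : ZMod L₀ → ((Fin d → ZMod L) → G)) (t : ZMod L₀) :
    FiniteTemperature.magSlice ρ t (fun e : FiniteTemperature.Site d L₀ L × FiniteTemperature.Dir d =>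
      e.2.elim (E e.1.1 e.1.2) fun i => V e.1.1 (e.1.2, i)) = magSum ρ (V t) := rfl

/-- `elecSlice t` of an assembled configuration is `elecSum` of the slices `t`, `t + 1` and the
temporal links at `t`. [folklore] -/
theorem elecSlice_assemble [NeZero L] (V : ZMod L₀ → ((Fin d → ZMod L) × Fin d → G))
    (E : ZMod L₀ → ((Fin d → ZMod L) → G)) (t : ZMod L₀) :
    FiniteTemperature.elecSlice ρ t (fun e : FiniteTemperature.Site d L₀ L × FiniteTemperature.Dir d =>
      e.2.elim (E e.1.1 e.1.2) fun i => V e.1.1 (e.1.2, i)) = elecSum ρ (V t) (E t) (V (t + 1)) := rfl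

/-- **The Boltzmann weight factorises over time**:
`e^{−S} = (∏_t e^{J_M magSum(V t)}) ∏_t e^{J_E elecSum(V t, E t, V (t+1))}`. [folklore] -/
theorem weight_assemble_eq_prod [NeZero L₀] [NeZero L] (JE JM : ℝ)
    (V : ZMod L₀ → ((Fin d → ZMod L) × Fin d → G)) (E : ZMod L₀ → ((Fin d → ZMod L) → G)) :
    FiniteTemperature.weight ρ JE JM
        (fun e : FiniteTemperature.Site d L₀ L × FiniteTemperature.Dir d =>
          e.2.elim (E e.1.1 e.1.2) fun i => V e.1.1 (e.1.2, i)) =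
      (∏ t : ZMod L₀, Real.exp (JM * magSum ρ (V t))) *
        ∏ t : ZMod L₀, Real.exp (JE * elecSum ρ (V t) (E t) (V (t + 1))) := by
  unfold FiniteTemperature.weight
  rw [FiniteTemperature.minusAction_eq_sum_slices, Real.exp_add, Finset.mul_sum, Finset.mul_sum,
    Real.exp_sum, Real.exp_sum, mul_comm]
  rfl

/-- **Symmetrisation of the cyclic chain**: `(∏_t e^{J m(V t)}) ∏_t M(V t, V (t+1)) =
∏_t e^{J m(V t)/2} M(V t, V (t+1)) e^{J m(V (t+1))/2}` (reindex `t + 1 ↦ t`). [folklore] -/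
theorem prod_exp_mul_prod_eq_prod_symm [NeZero L₀] {X : Type*} (m : X → ℝ) (M : X → X → ℝ)
    (J : ℝ) (V : ZMod L₀ → X) :
    (∏ t, Real.exp (J * m (V t))) * ∏ t, M (V t) (V (t + 1)) =
      ∏ t, Real.exp (J / 2 * m (V t)) * M (V t) (V (t + 1)) * Real.exp (J / 2 * m (V (t + 1))) := by
  rw [Finset.prod_mul_distrib, Finset.prod_mul_distrib]
  have hshift : ∏ t : ZMod L₀, Real.exp (J / 2 * m (V (t + 1))) = ∏ t, Real.exp (J / 2 * m (V t)) :=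
    Fintype.prod_equiv (Equiv.addRight 1) _ _ fun t => rfl
  have hsq : (fun t : ZMod L₀ => Real.exp (J * m (V t))) =
      fun t => Real.exp (J / 2 * m (V t)) * Real.exp (J / 2 * m (V t)) := by
    funext t; rw [← Real.exp_add]; ring_nf
  rw [hshift, hsq, Finset.prod_mul_distrib]
  ring

/-- Swapping the slices and inverting the temporal links: `Re tr ρ(e⁻¹ a e' b⁻¹) = Re tr ρ(e b e'⁻¹ a⁻¹)`
(unitary `ρ`). [folklore] -/
theorem trace_re_rep_plaquette_swap (hρu : ∀ g, ρ g ∈ Matrix.unitaryGroup (Fin N) ℂ)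
    (e e' a b : G) :
    (ρ (e⁻¹ * a * e'⁻¹⁻¹ * b⁻¹)).trace.re = (ρ (e * b * e'⁻¹ * a⁻¹)).trace.re := by
  have h1 : (e * b * e'⁻¹ * a⁻¹)⁻¹ = (a * e' * b⁻¹) * e⁻¹ := by group
  have h2 : e⁻¹ * a * e'⁻¹⁻¹ * b⁻¹ = e⁻¹ * (a * e' * b⁻¹) := by group
  calc (ρ (e⁻¹ * a * e'⁻¹⁻¹ * b⁻¹)).trace.re = (ρ (e⁻¹ * (a * e' * b⁻¹))).trace.re := by rw [h2]
    _ = (ρ ((a * e' * b⁻¹) * e⁻¹)).trace.re := by rw [map_mul ρ e⁻¹, Matrix.trace_mul_comm, ← map_mul]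
    _ = (ρ (e * b * e'⁻¹ * a⁻¹)⁻¹).trace.re := by rw [h1]
    _ = (ρ (e * b * e'⁻¹ * a⁻¹)).trace.re := FiniteTemperature.trace_re_rep_inv ρ hρu _

/-- **Swap symmetry of the temporal plaquette sum**: exchanging the two spatial slices and
inverting all temporal links leaves `elecSum` invariant (unitary `ρ`). [folklore] -/
theorem elecSum_swap_inv [NeZero L] (hρu : ∀ g, ρ g ∈ Matrix.unitaryGroup (Fin N) ℂ)
    (a b : (Fin d → ZMod L) × Fin d → G) (E : (Fin d → ZMod L) → G) :
    elecSum ρ b E⁻¹ a = elecSum ρ a E b := by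
  unfold elecSum
  refine Finset.sum_congr rfl fun x _ => Finset.sum_congr rfl fun i _ => ?_
  rw [Pi.inv_apply, Pi.inv_apply]
  exact trace_re_rep_plaquette_swap ρ hρu _ _ _ _

/-- `magSum` is continuous (continuous `ρ`). [folklore] -/
theorem continuous_magSum [NeZero L] [TopologicalSpace G] [IsTopologicalGroup G]
    (hρ : Continuous ρ) :
    Continuous (magSum (d := d) (L := L) ρ) := by
  have htr : Continuous fun g : G => (ρ g).trace.re :=
    Complex.continuous_re.comp (Continuous.matrix_trace hρ)
  have hc : ∀ q : (Fin d → ZMod L) × Fin d,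
      Continuous fun a : (Fin d → ZMod L) × Fin d → G => a q := fun q => continuous_apply q
  unfold magSum
  refine continuous_finsetSum _ fun x _ => continuous_finsetSum _ fun p _ => htr.comp ?_
  exact (((hc _).mul (hc _)).mul (hc _).inv).mul (hc _).inv

/-- `elecSum` is jointly continuous in (earlier slice, later slice, temporal links). [folklore] -/
theorem continuous_elecSum [NeZero L] [TopologicalSpace G] [IsTopologicalGroup G]
    (hρ : Continuous ρ) :
    Continuous fun z : (((Fin d → ZMod L) × Fin d → G) × ((Fin d → ZMod L) × Fin d → G)) ×
      ((Fin d → ZMod L) → G) => elecSum ρ z.1.1 z.2 z.1.2 := by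
  have htr : Continuous fun g : G => (ρ g).trace.re :=
    Complex.continuous_re.comp (Continuous.matrix_trace hρ)
  have hE : ∀ y : Fin d → ZMod L, Continuous fun z : (((Fin d → ZMod L) × Fin d → G) ×
      ((Fin d → ZMod L) × Fin d → G)) × ((Fin d → ZMod L) → G) => z.2 y :=
    fun y => (continuous_apply y).comp continuous_snd
  have ha : ∀ q, Continuous fun z : (((Fin d → ZMod L) × Fin d → G) ×
      ((Fin d → ZMod L) × Fin d → G)) × ((Fin d → ZMod L) → G) => z.1.1 q :=
    fun q => (continuous_apply q).comp (continuous_fst.comp continuous_fst)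
  have hb : ∀ q, Continuous fun z : (((Fin d → ZMod L) × Fin d → G) ×
      ((Fin d → ZMod L) × Fin d → G)) × ((Fin d → ZMod L) → G) => z.1.2 q :=
    fun q => (continuous_apply q).comp (continuous_snd.comp continuous_fst)
  unfold elecSum
  refine continuous_finsetSum _ fun x _ => continuous_finsetSum _ fun i _ => htr.comp ?_
  exact (((hE _).mul (hb _)).mul (hE _).inv).mul (ha _).inv

end Slices

section Kernel

variable {d L₀ L : ℕ} {G : Type*} [Group G] [TopologicalSpace G] [IsTopologicalGroup G] [CompactSpace G]
  [MeasurableSpace G] [BorelSpace G] {N : ℕ} (ρ : G →* Matrix (Fin N) (Fin N) ℂ)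

/-- The **time-sliced (symmetrised) transfer kernel of the Wilson action** with couplings
`J_E, J_M` on the spatial box `(ℤ/L)^d`: `K(a, b) = e^{J_M magSum(a)/2} (∫ e^{J_E elecSum(a, E, b)} dE)
e^{J_M magSum(b)/2}`, the temporal links between the two slices integrated against their product
Haar probability measure — the integral kernel of the transfer matrix `𝕋` of the periodic-time
lattice gauge theory in the "link representation" `L²` of the spatial links (no gauge fixing; the
integral over the temporal links implements the projection onto gauge-invariant states).
[cite: OsterwalderSeiler1978, §2–3] -/
def sliceKernel [NeZero L] (JE JM : ℝ) (a b : (Fin d → ZMod L) × Fin d → G) : ℝ :=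
  Real.exp (JM / 2 * magSum ρ a) *
    (∫ E, Real.exp (JE * elecSum ρ a E b) ∂(Measure.pi fun _ : Fin d → ZMod L => haarProbability G)) *
    Real.exp (JM / 2 * magSum ρ b)

/-- **The a-priori measure is the product of the slice measures**: pushing forward the product of
the Haar measures of the spatial and temporal slices along the assembling map gives
`FiniteTemperature.haar` (both are products of normalised Haar measures over the same links,
regrouped). [folklore] -/
theorem map_assemble_eq_haar [NeZero L₀] [NeZero L] :
    Measure.map (fun VE : (ZMod L₀ → ((Fin d → ZMod L) × Fin d → G)) ×
        (ZMod L₀ → ((Fin d → ZMod L) → G)) =>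
      fun e : FiniteTemperature.Site d L₀ L × FiniteTemperature.Dir d => e.2.elim (VE.2 e.1.1 e.1.2) fun i => VE.1 e.1.1 (e.1.2, i))
      ((Measure.pi fun _ : ZMod L₀ => Measure.pi fun _ : (Fin d → ZMod L) × Fin d =>
          haarProbability G).prod
        (Measure.pi fun _ : ZMod L₀ => Measure.pi fun _ : Fin d → ZMod L => haarProbability G)) =
      FiniteTemperature.haar d L₀ L G := by
  symm
  unfold FiniteTemperature.haar
  refine Measure.pi_eq fun s hs => ?_
  rw [Measure.map_apply measurable_assemble (MeasurableSet.univ_pi hs), preimage_assemble_pi,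
    Measure.prod_prod, Measure.pi_pi, Measure.pi_pi]
  simp_rw [Measure.pi_pi]
  rw [Fintype.prod_prod_type, mul_comm]
  simp_rw [Fintype.prod_option]
  rw [Finset.prod_mul_distrib, Fintype.prod_prod_type, Fintype.prod_prod_type]
  congr 1
  refine Finset.prod_congr rfl fun t _ => ?_
  rw [Fintype.prod_prod_type]

/-- **Integrals over configurations as integrals over (spatial, temporal) slices.** [folklore] -/
theorem integral_haar_eq_integral_assemble [NeZero L₀] [NeZero L] {Φ : FiniteTemperature.Config d L₀ L G → ℝ}
    (hΦ : Measurable Φ) :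
    ∫ U, Φ U ∂FiniteTemperature.haar d L₀ L G =
      ∫ VE, Φ (fun e : FiniteTemperature.Site d L₀ L × FiniteTemperature.Dir d => e.2.elim (VE.2 e.1.1 e.1.2) fun i => VE.1 e.1.1 (e.1.2, i))
        ∂((Measure.pi fun _ : ZMod L₀ => Measure.pi fun _ : (Fin d → ZMod L) × Fin d =>
            haarProbability G).prod
          (Measure.pi fun _ : ZMod L₀ => Measure.pi fun _ : Fin d → ZMod L => haarProbability G)) := by
  rw [← map_assemble_eq_haar, integral_map measurable_assemble.aemeasurable]
  rw [map_assemble_eq_haar]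
  exact hΦ.aestronglyMeasurable

/-- The integral over all temporal links of a product over time slices is the product of the
slice integrals (`integral_fintype_prod_eq_prod`). [folklore] -/
theorem integral_prod_temporalSlices [NeZero L₀] [NeZero L]
    (g : ZMod L₀ → ((Fin d → ZMod L) → G) → ℝ) :
    ∫ E : ZMod L₀ → (Fin d → ZMod L) → G, ∏ t, g t (E t)
        ∂(Measure.pi fun _ => Measure.pi fun _ => haarProbability G) =
      ∏ t, ∫ e, g t e ∂(Measure.pi fun _ => haarProbability G) :=
  integral_fintype_prod_eq_prod (𝕜 := ℝ) g

variable [SecondCountableTopology G]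

/-- **Continuity and positivity of `(a, b) ↦ ∫ e^{J q(a, E, b)} dE`** for a jointly continuous `q`
(dominated convergence on the compact parameter space; `integral_exp_pos`). [folklore] -/
theorem continuous_pos_integral_exp [NeZero L] {X : Type*} [TopologicalSpace X] [CompactSpace X]
    [FirstCountableTopology X] (q : X → ((Fin d → ZMod L) → G) → X → ℝ)
    (hq : Continuous fun z : (X × X) × ((Fin d → ZMod L) → G) => q z.1.1 z.2 z.1.2) (J : ℝ) :
    Continuous (fun p : X × X => ∫ E, Real.exp (J * q p.1 E p.2)
        ∂(Measure.pi fun _ : Fin d → ZMod L => haarProbability G)) ∧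
      ∀ a b, 0 < ∫ E, Real.exp (J * q a E b) ∂(Measure.pi fun _ : Fin d → ZMod L => haarProbability G) := by
  have hFc : Continuous fun z : (X × X) × ((Fin d → ZMod L) → G) => Real.exp (J * q z.1.1 z.2 z.1.2) :=
    Real.continuous_exp.comp (continuous_const.mul hq)
  obtain ⟨B, hB⟩ := isCompact_univ.exists_bound_of_continuousOn hFc.continuousOn
  refine ⟨?_, fun a b => ?_⟩
  · refine continuous_of_dominated (F := fun (p : X × X) (E : (Fin d → ZMod L) → G) =>
        Real.exp (J * q p.1 E p.2)) (bound := fun _ => B) (fun p => ?_) (fun p => ?_)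
      (integrable_const B) (Eventually.of_forall fun E => ?_)
    · exact (hFc.comp (Continuous.prodMk continuous_const continuous_id)).aestronglyMeasurable
    · exact Eventually.of_forall fun E => hB (p, E) (Set.mem_univ _)
    · exact hFc.comp (Continuous.prodMk continuous_id continuous_const)
  · exact integral_exp_pos (((hFc.comp (Continuous.prodMk (continuous_const (y := (a, b)))
      continuous_id)).integrable_of_hasCompactSupport
        (IsCompact.of_isClosed_subset isCompact_univ (isClosed_tsupport _) (Set.subset_univ _))))

/-- **The transfer kernel is jointly continuous.** [folklore] -/
theorem continuous_sliceKernel [NeZero L] (hρ : Continuous ρ) (JE JM : ℝ) :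
    Continuous (uncurry (sliceKernel (d := d) (L := L) ρ JE JM)) := by
  have hM := (continuous_pos_integral_exp (G := G) (elecSum (d := d) (L := L) ρ) (continuous_elecSum ρ hρ) JE).1
  have hm := continuous_magSum (d := d) (L := L) ρ hρ
  exact ((Real.continuous_exp.comp (continuous_const.mul (hm.comp continuous_fst))).mul hM).mul
    (Real.continuous_exp.comp (continuous_const.mul (hm.comp continuous_snd)))

/-- **The transfer kernel is strictly positive.** [folklore] -/
theorem sliceKernel_pos [NeZero L] (hρ : Continuous ρ) (JE JM : ℝ)
    (a b : (Fin d → ZMod L) × Fin d → G) : 0 < sliceKernel ρ JE JM a b := by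
  have hM := (continuous_pos_integral_exp (G := G) (elecSum (d := d) (L := L) ρ) (continuous_elecSum ρ hρ) JE).2
  exact mul_pos (mul_pos (Real.exp_pos _) (hM a b)) (Real.exp_pos _)

/-- **The transfer kernel is bounded** (continuity on a compact space). [folklore] -/
theorem exists_sliceKernel_le [NeZero L] (hρ : Continuous ρ) (JE JM : ℝ) :
    ∃ C : ℝ, ∀ a b : (Fin d → ZMod L) × Fin d → G, ‖sliceKernel ρ JE JM a b‖ ≤ C := by
  obtain ⟨C, hC⟩ := isCompact_univ.exists_bound_of_continuousOn
    (continuous_sliceKernel (d := d) (L := L) ρ hρ JE JM).continuousOn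
  exact ⟨C, fun a b => hC (a, b) (Set.mem_univ _)⟩

omit [SecondCountableTopology G] in
/-- **The transfer kernel is symmetric** (`E ↦ E⁻¹` in the temporal integral, inversion invariance
of the Haar probability measure, and `elecSum_swap_inv`; unitary `ρ`). This is the self-adjointness
of the transfer matrix. [cite: OsterwalderSeiler1978, §2–3] -/
theorem sliceKernel_symm [NeZero L] (hρu : ∀ g, ρ g ∈ Matrix.unitaryGroup (Fin N) ℂ) (JE JM : ℝ)
    (a b : (Fin d → ZMod L) × Fin d → G) : sliceKernel ρ JE JM a b = sliceKernel ρ JE JM b a := by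
  have hM : ∫ E, Real.exp (JE * elecSum ρ a E b) ∂(Measure.pi fun _ : Fin d → ZMod L => haarProbability G) =
      ∫ E, Real.exp (JE * elecSum ρ b E a) ∂(Measure.pi fun _ : Fin d → ZMod L => haarProbability G) := by
    rw [← integral_inv_eq_self (fun E : (Fin d → ZMod L) → G => Real.exp (JE * elecSum ρ b E a))]
    refine integral_congr_ae (Eventually.of_forall fun E => ?_)
    dsimp only
    rw [elecSum_swap_inv ρ hρu]
  unfold sliceKernel
  rw [hM]
  ring

/-- **Integrating out the temporal links.** For a continuous observable `Ψ` of the spatial links,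
`∫ Ψ e^{−S} dU = ∫ Ψ(V) (∏_t e^{J_M magSum(V t)}) (∏_t ∫ e^{J_E elecSum(V t, E, V (t+1))} dE) dV`
(Fubini over (spatial, temporal) slices and the product structure of the temporal integral).
[folklore] -/
theorem integral_obs_mul_weight_eq_integral_prod [NeZero L₀] [NeZero L] (hρ : Continuous ρ)
    (JE JM : ℝ) (Ψ : (ZMod L₀ → ((Fin d → ZMod L) × Fin d → G)) → ℝ) (hΨ : Continuous Ψ) :
    ∫ U, Ψ (fun t p => U ((t, p.1), some p.2)) * FiniteTemperature.weight ρ JE JM U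
        ∂FiniteTemperature.haar d L₀ L G =
      ∫ V, Ψ V * ((∏ t : ZMod L₀, Real.exp (JM * magSum ρ (V t))) *
        ∏ t : ZMod L₀, ∫ E : (Fin d → ZMod L) → G, Real.exp (JE * elecSum ρ (V t) E (V (t + 1)))
          ∂(Measure.pi fun _ => haarProbability G))
        ∂(Measure.pi fun _ : ZMod L₀ => Measure.pi fun _ : (Fin d → ZMod L) × Fin d =>
          haarProbability G) := by
  -- the integrand is continuous, hence measurable and integrable on the compact configuration space
  have hspat : Continuous fun (U : FiniteTemperature.Config d L₀ L G) (t : ZMod L₀)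
      (p : (Fin d → ZMod L) × Fin d) => U ((t, p.1), some p.2) :=
    continuous_pi fun t => continuous_pi fun p => continuous_apply _
  have hΦc : Continuous fun U : FiniteTemperature.Config d L₀ L G =>
      Ψ (fun t p => U ((t, p.1), some p.2)) * FiniteTemperature.weight ρ JE JM U :=
    (hΨ.comp hspat).mul (FiniteTemperature.continuous_weight ρ hρ JE JM)
  rw [integral_haar_eq_integral_assemble hΦc.measurable]
  have hint : Integrable (fun VE : (ZMod L₀ → ((Fin d → ZMod L) × Fin d → G)) ×
      (ZMod L₀ → ((Fin d → ZMod L) → G)) =>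
        Ψ (fun t p => (fun e : FiniteTemperature.Site d L₀ L × FiniteTemperature.Dir d =>
          e.2.elim (VE.2 e.1.1 e.1.2) fun i => VE.1 e.1.1 (e.1.2, i)) ((t, p.1), some p.2)) *
        FiniteTemperature.weight ρ JE JM
          (fun e : FiniteTemperature.Site d L₀ L × FiniteTemperature.Dir d =>
            e.2.elim (VE.2 e.1.1 e.1.2) fun i => VE.1 e.1.1 (e.1.2, i)))
      ((Measure.pi fun _ : ZMod L₀ => Measure.pi fun _ : (Fin d → ZMod L) × Fin d =>
          haarProbability G).prod
        (Measure.pi fun _ : ZMod L₀ => Measure.pi fun _ : Fin d → ZMod L => haarProbability G)) :=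
    (hΦc.comp continuous_assemble).integrable_of_hasCompactSupport
      (IsCompact.of_isClosed_subset isCompact_univ (isClosed_tsupport _) (Set.subset_univ _))
  rw [integral_prod _ hint]
  refine integral_congr_ae (Eventually.of_forall fun V => ?_)
  dsimp only
  simp_rw [weight_assemble_eq_prod ρ JE JM]
  simp only [Option.elim_some, Prod.mk.eta]
  have hprod := integral_prod_temporalSlices (G := G)
    (fun (t : ZMod L₀) (E : (Fin d → ZMod L) → G) => Real.exp (JE * elecSum ρ (V t) E (V (t + 1))))
  rw [integral_const_mul, integral_const_mul, hprod]

/-- **Transfer-matrix representation of the periodic-time Wilson ensemble.** For every temporal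
extent `L₀` and every continuous observable `Ψ` of the spatial links, the un-normalised Wilson
expectation is the cyclic kernel chain of the (`L₀`-independent) transfer kernel:
`∫ Ψ e^{−S} dU = ∫ Ψ(V) ∏_{t ∈ ℤ_{L₀}} K(V t, V (t+1)) dV`, `K = sliceKernel ρ J_E J_M` — the
path-space form of `Tr(⋯ 𝕋 ⋯ 𝕋)` (Osterwalder–Seiler 1978 §2–3; Lüscher 1977; Seiler LNP 159 §2).
[cite: OsterwalderSeiler1978, §2–3] -/
theorem integral_obs_mul_weight_eq_integral_sliceKernel [NeZero L₀] [NeZero L] (hρ : Continuous ρ)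
    (JE JM : ℝ) (Ψ : (ZMod L₀ → ((Fin d → ZMod L) × Fin d → G)) → ℝ) (hΨ : Continuous Ψ) :
    ∫ U, Ψ (fun t p => U ((t, p.1), some p.2)) * FiniteTemperature.weight ρ JE JM U
        ∂FiniteTemperature.haar d L₀ L G =
      ∫ V, Ψ V * ∏ t, sliceKernel ρ JE JM (V t) (V (t + 1))
        ∂(Measure.pi fun _ : ZMod L₀ => Measure.pi fun _ : (Fin d → ZMod L) × Fin d =>
          haarProbability G) := by
  rw [integral_obs_mul_weight_eq_integral_prod ρ hρ JE JM Ψ hΨ]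
  refine integral_congr_ae (Eventually.of_forall fun V => ?_)
  dsimp only
  rw [prod_exp_mul_prod_eq_prod_symm (magSum ρ)
    (fun a b => ∫ E, Real.exp (JE * elecSum ρ a E b)
      ∂(Measure.pi fun _ : Fin d → ZMod L => haarProbability G)) JM V]
  rfl

end Kernel

end Literature.MathematicalPhysics.QuantumFieldTheory

end
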